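import Mathlib
import Summits.ResolutionOfSingularities.ResolutionOfSingularities.Theorems.HomologicalConductorSurfaceTerminationReductionFourFacts
import Summits.ResolutionOfSingularities.ResolutionOfSingularities.Theorems.HomologicalConductorNoZenoCompositeDominator
import HarnessLib

/-!
# Crux `NoZenoR` (stmt-ResolutionOfSingularities-19943): THE EXACT RESIDUAL modulo four prints, MAXIMAL-KERNEL form

Route `ResolutionOfSingularities/HomologicalConductor` (cell decomp-res, hand leafhand-res-homologicalconduct-3 g1).
OURS: AI-written, weaker than expert review; nothing here is a statement of the manuscript under review
(Hironaka 2017).  SUPPORT level, counted 0.  Def-free, no new named facts.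

`…SurfaceTerminationReductionFourFacts.noZenoR_iff_topKernel_of_facts4` (this hand): modulo the four prints
{CJS 2020 Thm 1.2, Lipman (1.2), (4.1), (12.1)(ii)}, `NoZenoR` ⟺ (TOP-ker) «under `StrictDrop`, no admissible datum with
`dim A ≥ 3` and top-dimensional canonical tower has only non-noetherian weak dominators».  Here the kernel datum is
NORMALISED further by the tree's Zorn lemma `stub_maxDominator` (line `birth` of `NoZeno`) and dominance invariance
(`CompositeDominator.tower_eq_of_dominates`, `dominates_iff_of_dominates`): one may assume in addition that `O` is a
MAXIMAL weak dominator of its own tower — every valuation ring `O' > O` inverts a stage element that `O` does not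
(the registry's `hmax` binder of the v34 kernel stubs).  Result:

* `noZenoR_of_facts4_of_maxKernel` — `NoZenoR` BY NAME ⟸ four prints + (TOP-ker-max);
* `maxKernel_of_noZenoR` — the fact-free necessity;
* **`noZenoR_iff_maxKernel_of_facts4`** — modulo the four prints, `NoZenoR` ⟺ (TOP-ker-max) «under `StrictDrop`, there is
  NO admissible datum `(p, k, K, O, A)` with `dim A ≥ 3`, all stages of Krull dimension `dim A`, every weak dominator of the
  tower non-noetherian, and `O` maximal among the weak dominators».

This is the v34 registry's kernel block (`hker`, `hmax`) restricted to TOP-dimensional towers of dimension `≥ 3`, WITHOUT the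
exhaustion / transcendence-degree / induction binders — the common core of `stub_kernelHighF` (tr.deg `≥ 4`) and the tr.deg-3
residuals, re-cut by Krull dimension.  No crux, kill test or summit statement is proved; resolution in char p is NOT proved.
-/

-- single-problem summit: the doubled namespace component `ResolutionOfSingularities` is forced
set_option linter.dupNamespace false

noncomputable section

open Summit.ResolutionOfSingularities.ResolutionOfSingularities.Theses.HomologicalConductor
open Summit.ResolutionOfSingularities.ResolutionOfSingularities.Theorems
open Summit.ResolutionOfSingularities.ResolutionOfSingularities.Theorems.NoZeno.Birth
open Summit.ResolutionOfSingularities.ResolutionOfSingularities.Theorems.NoZeno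

namespace Summit.ResolutionOfSingularities.ResolutionOfSingularities.Theorems.SurfaceTermination.Reduction.FourFacts

/-- **`NoZenoR` (stmt-19943) BY NAME ⟸ FOUR prints + (TOP-ker-max)**: given a top-dimensional kernel datum `(O, A)` of
dimension `≥ 3`, replace `O` by a MAXIMAL weak dominator `Om ≥ O` of the tower (`stub_maxDominator`): the `Om`-tower IS the
`O`-tower (`CompositeDominator.tower_eq_of_dominates`), its weak dominators w.r.t. `Om` are those of the `O`-tower w.r.t. `O`
(`dominates_iff_of_dominates`), so `(Om, A)` is a MAXIMAL top-dimensional kernel datum — excluded by (TOP-ker-max).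
[cite: ZariskiSamuel1960, Ch. VI §5, §10] [cite: Lipman1969, (1.2), (4.1), (12.1)(ii)] [cite: CossartJannsenSaito2020, Thm. 1.2] -/
theorem noZenoR_of_facts4_of_maxKernel
    (hF : (Literature.AlgebraicGeometry.Resolution.CossartJannsenSaito2020General.{0} ∧
      Literature.AlgebraicGeometry.Resolution.Lipman1969_1_2.{0} ∧
      Literature.AlgebraicGeometry.Resolution.Lipman1969_4_1.{0} ∧
      Literature.AlgebraicGeometry.Resolution.Lipman1969_12_1_ii.{0}))
    (hMax : StrictDrop → ∀ p : ℕ, p.Prime → ∀ (k K : Type) [Field k] [CharP k p] [Field K] [Algebra k K]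
      (O : ValuationSubring K) (A : Subalgebra k K), (∀ c : k, algebraMap k K c ∈ O) → A.FG →
      IsFractionRing ↥A K → A.toSubring ≤ O.toSubring → ¬ ringKrullDim ↥A ≤ 2 →
      (∀ n : ℕ, ringKrullDim ↥(tower O A n) = ringKrullDim ↥A) →
      (∀ O' : ValuationSubring K,
        (∀ m : ℕ, ∀ s ∈ tower O A m, s ∈ O' ∧ (s⁻¹ ∈ O' → s⁻¹ ∈ O)) → ¬ IsNoetherianRing ↥O') →
      (∀ O' : ValuationSubring K, O < O' → ∃ m : ℕ, ∃ s ∈ tower O A m, s⁻¹ ∈ O' ∧ s⁻¹ ∉ O) → False) :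
    NoZenoR := by
  refine noZenoR_of_facts4_of_topKernel hF fun hD p hp k K _ _ _ _ O A hk hA hfr hAO hnot htop hker => ?_
  -- a maximal weak dominator `Om ≥ O` of the tower
  obtain ⟨Om, _, hdom, hmax⟩ := stub_maxDominator k K O A hk hAO
  have hT : ∀ m : ℕ, tower Om A m = tower O A m :=
    CompositeDominator.tower_eq_of_dominates O A Om hk hA hfr hAO hdom
  have hk' : ∀ c : k, algebraMap k K c ∈ Om := CompositeDominator.algebraMap_mem_of_dominates O A Om hdom
  have hAO' : A.toSubring ≤ Om.toSubring := CompositeDominator.le_of_dominates O A Om hdom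
  -- the `(Om, A)` datum is top-dimensional, kernel, and maximal
  have htop' : ∀ n : ℕ, ringKrullDim ↥(tower Om A n) = ringKrullDim ↥A := fun n => by rw [hT n]; exact htop n
  have hker' : ∀ U : ValuationSubring K,
      (∀ m : ℕ, ∀ s ∈ tower Om A m, s ∈ U ∧ (s⁻¹ ∈ U → s⁻¹ ∈ Om)) → ¬ IsNoetherianRing ↥U :=
    fun U hU => hker U ((CompositeDominator.dominates_iff_of_dominates O A Om hk hA hfr hAO hdom U).mp hU)
  have hmax' : ∀ O' : ValuationSubring K, Om < O' → ∃ m : ℕ, ∃ s ∈ tower Om A m, s⁻¹ ∈ O' ∧ s⁻¹ ∉ Om := by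
    intro O' hlt
    obtain ⟨m, s, hs, hinv, hninv⟩ := hmax O' hlt
    exact ⟨m, s, (hT m).symm ▸ hs, hinv, hninv⟩
  exact hMax hD p hp k K Om A hk' hA hfr hAO' hnot htop' hker' hmax'

/-- **(TOP-ker-max) is NECESSARY** (fact-free): `NoZenoR` excludes every kernel datum whatsoever (with `StrictDrop` and the tree
theorem `PersistenceRadical` every tower terminates, and a regular stage has a discrete weak dominator,
`DiscreteDominator.not_isRegularLocalRing_of_kernel`), in particular the maximal top-dimensional ones. [this work; composition of tree results] -/
theorem maxKernel_of_noZenoR (h : NoZenoR) :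
    StrictDrop → ∀ p : ℕ, p.Prime → ∀ (k K : Type) [Field k] [CharP k p] [Field K] [Algebra k K]
      (O : ValuationSubring K) (A : Subalgebra k K), (∀ c : k, algebraMap k K c ∈ O) → A.FG →
      IsFractionRing ↥A K → A.toSubring ≤ O.toSubring → ¬ ringKrullDim ↥A ≤ 2 →
      (∀ n : ℕ, ringKrullDim ↥(tower O A n) = ringKrullDim ↥A) →
      (∀ O' : ValuationSubring K,
        (∀ m : ℕ, ∀ s ∈ tower O A m, s ∈ O' ∧ (s⁻¹ ∈ O' → s⁻¹ ∈ O)) → ¬ IsNoetherianRing ↥O') →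
      (∀ O' : ValuationSubring K, O < O' → ∃ m : ℕ, ∃ s ∈ tower O A m, s⁻¹ ∈ O' ∧ s⁻¹ ∉ O) → False :=
  fun hD p hp k K _ _ _ _ O A hk hA hfr hAO _ _ hker _ => by
    obtain ⟨M, hM⟩ := NoZeno.DiscreteDominator.noZenoR_iff.mp h
      Theorems.persistenceRadical_proof hD p hp k K O A hk hA hfr hAO
    exact NoZeno.DiscreteDominator.not_isRegularLocalRing_of_kernel O A hk hfr hAO hker M hM

/-- **THE EXACT RESIDUAL OF THE CRUX `NoZenoR` MODULO FOUR PRINTS, maximal-kernel form**: given CJS 2020 Thm 1.2 and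
Lipman (1.2), (4.1), (12.1)(ii), `NoZenoR` ⟺ (TOP-ker-max) «under `StrictDrop`, no admissible datum with `dim A ≥ 3`, all stages
of Krull dimension `dim A`, only non-noetherian weak dominators, and `O` maximal among them».
[cite: Lipman1969, (1.2), (4.1), (12.1)(ii)] [cite: CossartJannsenSaito2020, Thm. 1.2] [cite: ZariskiSamuel1960, Ch. VI §5] -/
theorem noZenoR_iff_maxKernel_of_facts4
    (hF : (Literature.AlgebraicGeometry.Resolution.CossartJannsenSaito2020General.{0} ∧
      Literature.AlgebraicGeometry.Resolution.Lipman1969_1_2.{0} ∧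
      Literature.AlgebraicGeometry.Resolution.Lipman1969_4_1.{0} ∧
      Literature.AlgebraicGeometry.Resolution.Lipman1969_12_1_ii.{0})) :
    NoZenoR ↔
      (StrictDrop → ∀ p : ℕ, p.Prime → ∀ (k K : Type) [Field k] [CharP k p] [Field K] [Algebra k K]
        (O : ValuationSubring K) (A : Subalgebra k K), (∀ c : k, algebraMap k K c ∈ O) → A.FG →
        IsFractionRing ↥A K → A.toSubring ≤ O.toSubring → ¬ ringKrullDim ↥A ≤ 2 →
        (∀ n : ℕ, ringKrullDim ↥(tower O A n) = ringKrullDim ↥A) →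
        (∀ O' : ValuationSubring K,
          (∀ m : ℕ, ∀ s ∈ tower O A m, s ∈ O' ∧ (s⁻¹ ∈ O' → s⁻¹ ∈ O)) → ¬ IsNoetherianRing ↥O') →
        (∀ O' : ValuationSubring K, O < O' → ∃ m : ℕ, ∃ s ∈ tower O A m, s⁻¹ ∈ O' ∧ s⁻¹ ∉ O) → False) :=
  ⟨maxKernel_of_noZenoR, noZenoR_of_facts4_of_maxKernel hF⟩

end Summit.ResolutionOfSingularities.ResolutionOfSingularities.Theorems.SurfaceTermination.Reduction.FourFacts

end
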